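import Summits.Ventures.PercRepro.S1CoreLPCells
import Summits.Ventures.PercRepro.S1Ladder

/-!
# PercRepro — THE COLOOP STEP OF THE LEVEL-`4` CELLS, AND THE DELETION TRANSFER (p2, gen 29; SUBCLAIM-S1
§6.10 (xviii))

A coloop `e` of `M` (rank `r + 1 > 5`) leaves `#U` unchanged and gives `#Y_M ≥ 2·#Y_{M ∖ e} + 2·#U_{M ∖ e}`
(S1Ladder's lossy step), so `RLS (M ∖ e) r 4` implies `RLS M (r + 1) 4` as soon as `Φ(r + 1, 4) ≤ 2·Φ(r, 4) + 2` —
which holds at every `r ≤ 8` used here (`6/5, 14/5, 76/15, 42/5`). Deleting a coloop keeps the pair ranks, the line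
bound and the corank, and lowers the rank by one: a cell with coloops reduces to the cell of the next lower rank at
the same corank, down to the diagonal `(6, 4)` (`SixFour.rls_six_four_holds`, every finite matroid). Nothing is
claimed about any cell.

* **`rls_succ_of_isColoop`**; `ncard_ground_delete_singleton`, `pairs_delete_singleton`, `lines_delete_singleton`;
  `phiK_seven_le`, `phiK_eight_le`, `phiK_nine_le`.
Axioms: standard.
-/

open scoped Matroid

namespace PercRepro

namespace S1

open Set

variable {α : Type}

/-- **THE COLOOP STEP**: `e` a coloop of `M`, `r(M) = r + 1`, `r > 4`, `Φ(r+1, 4) ≤ 2Φ(r, 4) + 2`: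
`RLS (M ∖ e) r 4 → RLS M (r + 1) 4`. -/
theorem rls_succ_of_isColoop (M : Matroid α) [M.Finite] {e : α} (he : M.IsColoop e) {r : ℕ}
    (hR : M.eRank = ((r + 1 : ℕ) : ℕ∞)) (hr : 4 < r) (hΦ : phiK (r + 1) 4 ≤ 2 * phiK r 4 + 2)
    (hN : ThmN.RLS (M ＼ {e}) r 4) : ThmN.RLS M (r + 1) 4 := by
  rw [ThmN.RLS_iff] at hN ⊢
  have htop : Matroid.topCount M (r + 1) 4 = Matroid.topCount (M ＼ {e}) r 4 :=
    Matroid.topCount_eq_of_isColoop_of_eRank he 3 hR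
  rw [htop]
  have h := two_mul_midCount_add_le_of_isColoop M he hr
  have h' : 2 * (Matroid.midCount (M ＼ {e}) r 4 : ℚ) + 2 * (Matroid.topCount (M ＼ {e}) r 4 : ℚ) ≤
      (Matroid.midCount M (r + 1) 4 : ℚ) := by exact_mod_cast h
  have hT : (0 : ℚ) ≤ (Matroid.topCount (M ＼ {e}) r 4 : ℚ) := by positivity
  nlinarith [mul_le_mul_of_nonneg_right hΦ hT]

/-- Deleting a point lowers the size of the ground set by one. -/
theorem ncard_ground_delete_singleton (M : Matroid α) [M.Finite] {e : α} (he : e ∈ M.E) :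
    (M ＼ {e}).E.ncard + 1 = M.E.ncard := by
  rw [Matroid.delete_ground, ncard_sdiff' (singleton_subset_iff.mpr he) M.ground_finite, ncard_singleton]
  have : 1 ≤ M.E.ncard := by
    have := ncard_le_ncard (singleton_subset_iff.mpr he) M.ground_finite
    rwa [ncard_singleton] at this
  omega

/-- Deleting a point keeps the pair ranks. -/
theorem pairs_delete_singleton (M : Matroid α) (e : α)
    (hpairs : ∀ e ∈ M.E, ∀ f ∈ M.E, e ≠ f → M.eRk {e, f} = 2) :
    ∀ a ∈ (M ＼ {e}).E, ∀ b ∈ (M ＼ {e}).E, a ≠ b → (M ＼ {e}).eRk {a, b} = 2 := by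
  intro a ha b hb hab
  rw [Matroid.delete_ground] at ha hb
  have hsub : ({a, b} : Set α) ⊆ M.E := by
    intro x hx
    rcases hx with rfl | rfl
    · exact ha.1
    · exact hb.1
  have hnot : e ∉ ({a, b} : Set α) := by
    intro hx
    rcases hx with rfl | rfl
    · exact ha.2 (mem_singleton _)
    · exact hb.2 (mem_singleton _)
  rw [Matroid.eRk_delete_of_notMem hsub hnot]
  exact hpairs a ha.1 b hb.1 hab

/-- Deleting a point keeps the line bound. -/
theorem lines_delete_singleton (M : Matroid α) (e : α) (hlines : ∀ L ⊆ M.E, M.eRk L = 2 → L.ncard ≤ 3) :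
    ∀ L ⊆ (M ＼ {e}).E, (M ＼ {e}).eRk L = 2 → L.ncard ≤ 3 := by
  intro L hL hr
  rw [Matroid.delete_ground] at hL
  have hnot : e ∉ L := fun h => (hL h).2 (mem_singleton e)
  rw [Matroid.eRk_delete_of_notMem (hL.trans sdiff_subset) hnot] at hr
  exact hlines L (hL.trans sdiff_subset) hr

/-- `Φ(7, 4) ≤ 2Φ(6, 4) + 2`. -/
theorem phiK_seven_le : phiK 7 4 ≤ 2 * phiK 6 4 + 2 := by
  rw [PercRepro.phiK_seven_four, PercRepro.phiK_six_four]; norm_num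

/-- `Φ(8, 4) ≤ 2Φ(7, 4) + 2`. -/
theorem phiK_eight_le : phiK 8 4 ≤ 2 * phiK 7 4 + 2 := by
  rw [phiK_eight_four, PercRepro.phiK_seven_four]; norm_num

/-- `Φ(9, 4) ≤ 2Φ(8, 4) + 2`. -/
theorem phiK_nine_le : phiK 9 4 ≤ 2 * phiK 8 4 + 2 := by
  rw [phiK_nine_four, phiK_eight_four]; norm_num

end S1

end PercRepro
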